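import Summits.QuantumFields.BalabanUV.T4Continuum.Support.DirichletStarRenormTower
import Summits.QuantumFields.BalabanUV.Beta.GAN24.DirichletBoxTwoLevel
import Literature.MathematicalPhysics.QuantumFieldTheory.Balaban1983to89.B5G183FreeRowSum

/-!
# T⁴ programme, spine node NE2 (U1a), sub-row Δ1 «NE2⁰-Dirichlet» — BOUNDARY CHARGES OF THE STAR BONDS AND REGIONS WITHOUT
# RE-ENTRANT CONTACT: `Σ_ν ‖∇_ν ιA‖² = Σ_ν ‖igrad_ν A‖² + n²·Σ_b cntR(b)·‖A b‖²` (any region); product regions satisfy H1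

NE2 formalisation swarm `b2b-balaban-t4-ne2-formalise-*`, LEAF PROVER 07 (gen 7), supplier item «Δ1-VEC-INTERIOR-W2-BOX» (own initiative,
`CLAIMS.log` INTENT; owner R29 successor list (ii) «interior W2 with a level-uniform constant on convex regions — discrete Gaffney with the
region gauge term»), file 1 of 3 (file 2 `Support/RegionInteriorGaffney`: the interior Gaffney inequality with constant 1; file 3
`Support/RegionInteriorW2`: interior W2 ⟸ W1 on product regions).  THIS FILE (geometry and one summation identity):

 * §1 `norm_sum_sq_le_of_pairwise` (a finite sum with at most one non-zero term); the neighbours `nbr x (μ, ±)` of a fine site and the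
   lattice-geometric hypothesis **`AtMostOneNeighbour n M S`** (H1): every site OUTSIDE `Ω = blockReg S` has at most one of its `2d`
   neighbours inside `Ω` — TRUE for every PRODUCT region `IsCoordBox M S` at every level `n ≥ 2` (**`atMostOneNeighbour_of_isCoordBox`**,
   from `RegionGaugeFixedVectorFlat.blockOf_add_unitVec` and `DirichletStarVectorTower.digit_eq_of_blockOf_ne` / `blockOf_sub_unitVec`),
   FALSE at a re-entrant corner (the notch site has two);
 * §2 **`sum_nsq_fdiff_ext_eq`** (ANY region): the zero-extension gradient energy of a field on the star bonds splits as
   `Σ_ν ‖∇_ν ιA‖² = Σ_ν ‖igrad_ν A‖² + n²·Σ_{b star} cntR(b)·‖A b‖²` — interior differences (`DirichletStarRenormTower.igrad`) plus the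
   BOUNDARY CHARGES `cntR b` = the number of NON-star translates `b ± e_ν` (`nsq_fdiff_ext_eq` per direction; the incoming jumps are moved
   onto the star bonds by the translation `c ↦ c + e_ν`, `sum_nonstar_shift`).

HONEST FRAMING (T4-DAG p. 1).  Lattice calculus at MODEL level (`U = 1`, ONE region, finite torus); statements OURS ([folklore]); nothing
printed is a hypothesis; re-entrant unions are NOT covered; W1 (`SliceCoercive`, G-ne2leaf07g5-1) OPEN; NE2 (U1a) NOT proved; spine 0/9
unchanged; NOT [B9] (3.16)/(3.23)–(3.27) as printed; NOT infinite volume, NOT a mass gap, NOT the Clay problem, NOT summit progress.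
HONEST DEPENDENCY: continuum YM on T⁴ ⇐ BetaPertH ∧ nine spine estimates (0/9 proved); BetaPertH ⇐ (D1) ∧ (D4) ∧ CAP+tail; G-an2-4
gates asym, D1 and NE2/3/4.  No `sorry`.
-/

noncomputable section

open scoped BigOperators ComplexConjugate Matrix Matrix.Norms.L2Operator
open Finset

namespace Summit.QuantumFields.BalabanUV.T4Continuum.RegionStarBoundaryCharges

open Literature.MathematicalPhysics.QuantumFieldTheory.Balaban1983to89.B5Prop11Plancherel (Tor fine fdiff unitVec)
open Literature.MathematicalPhysics.QuantumFieldTheory.Balaban1983to89.B5Prop11Lower (nsq nsq_nonneg)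
open Literature.MathematicalPhysics.QuantumFieldTheory.Balaban1983to89.B5G183FreeRowSum (fdiff_mulVec)
open Literature.MathematicalPhysics.QuantumFieldTheory.Balaban1983to89.B5Blocks16 (blockOf)
open Summit.QuantumFields.BalabanUV.T4Continuum
open Summit.QuantumFields.BalabanUV.T4Continuum.SubtypeCompression (ext ext_apply_of ext_apply_of_not)
open Summit.QuantumFields.BalabanUV.T4Continuum.RegionGaugeFixedVector (starReg)
open Summit.QuantumFields.BalabanUV.T4Continuum.RegionGaugeFixedVectorFlat (blockOf_add_unitVec)
open Summit.QuantumFields.BalabanUV.T4Continuum.ScalarBlockTrialFunction (digits)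
open Summit.QuantumFields.BalabanUV.T4Continuum.DirichletStarVectorTower (digit_eq_of_blockOf_ne blockOf_sub_unitVec)
open Summit.QuantumFields.BalabanUV.T4Continuum.DirichletStarRenormTower (igrad)
open Summit.QuantumFields.BalabanUV.Beta.GAN24.DirichletBoxTrace (blockReg)
open Summit.QuantumFields.BalabanUV.Beta.GAN24.DirichletBoxTwoLevel (IsCoordBox)

variable {d : ℕ}

/-! ## §1 A sum with at most one non-zero term; neighbours; the hypothesis H1 -/

/-- if at most one term of a finite family is non-zero, `‖Σ w‖² ≤ Σ ‖w‖²`. [folklore] -/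
theorem norm_sum_sq_le_of_pairwise {ι : Type*} [Fintype ι] [DecidableEq ι] (w : ι → ℂ)
    (h : ∀ i j, i ≠ j → w i = 0 ∨ w j = 0) : ‖∑ i, w i‖ ^ 2 ≤ ∑ i, ‖w i‖ ^ 2 := by
  by_cases hex : ∃ i, w i ≠ 0
  · obtain ⟨i₀, hi₀⟩ := hex
    have hz : ∀ j ∈ (univ : Finset ι), j ≠ i₀ → w j = 0 := fun j _ hj => (h j i₀ hj).resolve_right hi₀
    rw [sum_eq_single i₀ hz (fun hh => absurd (mem_univ _) hh)]
    exact single_le_sum (f := fun i => ‖w i‖ ^ 2) (fun i _ => sq_nonneg _) (mem_univ i₀)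
  · push Not at hex
    simp [hex]

section Region

variable (n : ℕ) [NeZero n] (M : Fin d → ℕ) [hM : ∀ μ, NeZero (M μ)]

/-- the neighbour of a site in direction `i.1`, forward (`i.2 = true`) or backward (`i.2 = false`). [folklore] -/
def nbr (x : Tor (fine n M)) (i : Fin d × Bool) : Tor (fine n M) :=
  if i.2 then x + unitVec (fine n M) i.1 else x - unitVec (fine n M) i.1

variable (S : Tor M → Prop) [DecidablePred S]

/-- **H1 — NO RE-ENTRANT CONTACT**: every site outside `Ω = blockReg S` has at most one of its `2d` lattice neighbours inside `Ω`
(a lattice-geometric predicate on the region; product regions satisfy it at `n ≥ 2`, re-entrant corners violate it). [folklore] -/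
def AtMostOneNeighbour : Prop :=
  ∀ x : Tor (fine n M), ¬ blockReg n M S x →
    ∀ i j : Fin d × Bool, blockReg n M S (nbr n M x i) → blockReg n M S (nbr n M x j) → i = j

omit [DecidablePred S] in
/-- a unit step changes the block only in its own coordinate (forward). [folklore] -/
theorem blockOf_add_unitVec_apply_of_ne (x : Tor (fine n M)) {μ ν : Fin d} (h : ν ≠ μ) :
    blockOf n M (x + unitVec (fine n M) μ) ν = blockOf n M x ν := by
  rcases blockOf_add_unitVec n M x μ with h1 | h2
  · rw [h1]
  · rw [h2, Pi.add_apply, unitVec, Pi.single_eq_of_ne h, add_zero]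

omit [DecidablePred S] in
/-- a unit step changes the block only in its own coordinate (backward). [folklore] -/
theorem blockOf_sub_unitVec_apply_of_ne (x : Tor (fine n M)) {μ ν : Fin d} (h : ν ≠ μ) :
    blockOf n M (x - unitVec (fine n M) μ) ν = blockOf n M x ν := by
  have e := blockOf_add_unitVec_apply_of_ne n M (x - unitVec (fine n M) μ) h
  rw [sub_add_cancel] at e
  exact e.symm

omit [DecidablePred S] in
/-- hence: the neighbour `nbr x (μ, s)` has the same block coordinates as `x` off `μ`. [folklore] -/
theorem blockOf_nbr_apply_of_ne (x : Tor (fine n M)) (i : Fin d × Bool) {ν : Fin d} (h : ν ≠ i.1) :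
    blockOf n M (nbr n M x i) ν = blockOf n M x ν := by
  unfold nbr
  split_ifs
  · exact blockOf_add_unitVec_apply_of_ne n M x h
  · exact blockOf_sub_unitVec_apply_of_ne n M x h

omit [DecidablePred S] in
/-- at `n ≥ 2` a site cannot leave its block both forwards and backwards in the same direction. [folklore] -/
theorem not_both_exits (hn : 2 ≤ n) (x : Tor (fine n M)) (μ : Fin d)
    (h1 : blockOf n M (x + unitVec (fine n M) μ) ≠ blockOf n M x) (h2 : blockOf n M (x - unitVec (fine n M) μ) ≠ blockOf n M x) :
    False :=
  h2 (blockOf_sub_unitVec n M hn x μ (digit_eq_of_blockOf_ne n M x μ h1))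

omit [DecidablePred S] in
/-- **PRODUCT REGIONS HAVE NO RE-ENTRANT CONTACT** (at every level `n ≥ 2`). [folklore] -/
theorem atMostOneNeighbour_of_isCoordBox [DecidablePred S] (hn : 2 ≤ n) (hS : IsCoordBox M S) : AtMostOneNeighbour n M S := by
  obtain ⟨S₀, hS₀⟩ := hS
  intro x hx i j hi hj
  -- the block coordinate of `x` that fails lies in the direction of BOTH neighbours
  have hx' : ¬ ∀ ν, blockOf n M x ν ∈ S₀ ν := fun h => hx ((hS₀ _).mpr h)
  obtain ⟨ν, hν⟩ := not_forall.mp hx'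
  have hi' : ∀ ν', blockOf n M (nbr n M x i) ν' ∈ S₀ ν' := (hS₀ _).mp hi
  have hj' : ∀ ν', blockOf n M (nbr n M x j) ν' ∈ S₀ ν' := (hS₀ _).mp hj
  have hνi : ν = i.1 := by
    by_contra hne
    exact hν (by rw [← blockOf_nbr_apply_of_ne n M x i hne]; exact hi' ν)
  have hνj : ν = j.1 := by
    by_contra hne
    exact hν (by rw [← blockOf_nbr_apply_of_ne n M x j hne]; exact hj' ν)
  have hij : i.1 = j.1 := hνi.symm.trans hνj
  -- same direction: the two signs cannot both enter `Ω`
  have hne_i : blockOf n M (nbr n M x i) ≠ blockOf n M x := fun e => hν (by rw [hνi, ← e]; exact hi' i.1)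
  have hne_j : blockOf n M (nbr n M x j) ≠ blockOf n M x := fun e => hν (by rw [hνj, ← e]; exact hj' j.1)
  obtain ⟨μ, s⟩ := i
  obtain ⟨μ', t⟩ := j
  simp only at hij
  subst hij
  have key : s = t := by
    by_contra hst
    unfold nbr at hne_i hne_j
    simp only at hne_i hne_j
    cases s <;> cases t
    · exact hst rfl
    · simp only [if_true, Bool.false_eq_true, if_false] at hne_i hne_j
      exact not_both_exits n M hn x μ hne_j hne_i
    · simp only [if_true, Bool.false_eq_true, if_false] at hne_i hne_j
      exact not_both_exits n M hn x μ hne_i hne_j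
    · exact hst rfl
  rw [key]

/-! ## §2 The decomposition of the zero-extension gradient energy (any region) -/

/-- THE BOUNDARY CHARGE of a bond: the number of NON-star translates `b ± e_ν`, `ν = 1, …, d` (as a real number). [folklore] -/
def cntR (b : Tor (fine n M) × Fin d) : ℝ :=
  ∑ ν : Fin d, ((if starReg n M S (b.1 + unitVec (fine n M) ν, b.2) then (0 : ℝ) else 1)
    + (if starReg n M S (b.1 - unitVec (fine n M) ν, b.2) then (0 : ℝ) else 1))

/-- `0 ≤ cntR`. [folklore] -/
theorem cntR_nonneg (b : Tor (fine n M) × Fin d) : 0 ≤ cntR n M S b :=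
  sum_nonneg fun ν _ => add_nonneg (by split_ifs <;> norm_num) (by split_ifs <;> norm_num)

/-- a sum over the non-star bonds, as a sum over all bonds with an indicator, re-expressed on the star bonds after the translation
`c ↦ c + e_ν`. [folklore] -/
theorem sum_nonstar_shift (ν : Fin d) (A : {b // starReg n M S b} → ℂ) :
    ∑ z : {b // ¬ starReg n M S b}, ‖ext (starReg n M S) A (z.1.1 + unitVec (fine n M) ν, z.1.2)‖ ^ 2
      = ∑ y : {b // starReg n M S b}, (if starReg n M S (y.1.1 - unitVec (fine n M) ν, y.1.2) then (0 : ℝ) else ‖A y‖ ^ 2) := by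
  -- as a sum over all bonds
  set F : Tor (fine n M) × Fin d → ℝ := fun c =>
    if starReg n M S c then 0 else ‖ext (starReg n M S) A (c.1 + unitVec (fine n M) ν, c.2)‖ ^ 2 with hF
  have h1 : ∑ z : {b // ¬ starReg n M S b}, ‖ext (starReg n M S) A (z.1.1 + unitVec (fine n M) ν, z.1.2)‖ ^ 2 = ∑ c, F c := by
    rw [← Fintype.sum_subtype_add_sum_subtype (starReg n M S) F]
    have h0 : ∑ y : {b // starReg n M S b}, F y = 0 := sum_eq_zero fun y _ => by simp only [hF, y.2, if_true]
    rw [h0, zero_add]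
    exact sum_congr rfl fun z _ => by simp only [hF, z.2, if_false]
  -- translate
  set e : Tor (fine n M) × Fin d ≃ Tor (fine n M) × Fin d := Equiv.prodCongr (Equiv.addRight (unitVec (fine n M) ν)) (Equiv.refl _)
    with he
  set G : Tor (fine n M) × Fin d → ℝ := fun c =>
    if starReg n M S (c.1 - unitVec (fine n M) ν, c.2) then 0 else ‖ext (starReg n M S) A c‖ ^ 2 with hG
  have h2 : ∑ c, F c = ∑ c, G c := by
    refine Fintype.sum_equiv e F G fun c => ?_
    simp only [hF, hG, he, Equiv.prodCongr_apply, Equiv.coe_addRight, Equiv.coe_refl, Prod.map_apply', id_eq,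
      add_sub_cancel_right]
  -- back to the star bonds
  have h3 : ∑ c, G c = ∑ y : {b // starReg n M S b},
      (if starReg n M S (y.1.1 - unitVec (fine n M) ν, y.1.2) then (0 : ℝ) else ‖A y‖ ^ 2) := by
    rw [← Fintype.sum_subtype_add_sum_subtype (starReg n M S) G]
    have h0 : ∑ z : {b // ¬ starReg n M S b}, G z = 0 := sum_eq_zero fun z _ => by
      simp only [hG]
      split_ifs
      · rfl
      · rw [ext_apply_of_not _ _ z.2, norm_zero, zero_pow two_ne_zero]
    rw [h0, add_zero]
    refine sum_congr rfl fun y _ => ?_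
    simp only [hG]
    split_ifs
    · rfl
    · rw [ext_apply_of]
  rw [h1, h2, h3]

/-- **ONE DIRECTION**: `‖∇_ν ιA‖² = ‖igrad_ν A‖² + n²·Σ_{y star} ([y + e_ν not star] + [y − e_ν not star])·‖A y‖²`. [folklore] -/
theorem nsq_fdiff_ext_eq (ν : Fin d) (A : {b // starReg n M S b} → ℂ) :
    nsq (fdiff (fine n M) (n : ℂ) ν *ᵥ ext (starReg n M S) A)
      = nsq (igrad M S n ν A) + (n : ℝ) ^ 2 * ∑ y : {b // starReg n M S b},
          ((if starReg n M S (y.1.1 + unitVec (fine n M) ν, y.1.2) then (0 : ℝ) else ‖A y‖ ^ 2)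
            + (if starReg n M S (y.1.1 - unitVec (fine n M) ν, y.1.2) then (0 : ℝ) else ‖A y‖ ^ 2)) := by
  set Φ : Tor (fine n M) × Fin d → ℝ := fun c =>
    ‖(n : ℂ) * (ext (starReg n M S) A (c.1 + unitVec (fine n M) ν, c.2) - ext (starReg n M S) A c)‖ ^ 2 with hΦ
  have hL : nsq (fdiff (fine n M) (n : ℂ) ν *ᵥ ext (starReg n M S) A) = ∑ c, Φ c := by
    unfold nsq
    exact sum_congr rfl fun c _ => by rw [fdiff_mulVec]
  -- star bonds: interior difference, or an outgoing jump
  have h1 : ∀ y : {b // starReg n M S b}, Φ y.1 = ‖igrad M S n ν A y‖ ^ 2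
      + (n : ℝ) ^ 2 * (if starReg n M S (y.1.1 + unitVec (fine n M) ν, y.1.2) then (0 : ℝ) else ‖A y‖ ^ 2) := by
    intro y
    simp only [hΦ]
    rw [ext_apply_of]
    unfold igrad
    by_cases h : starReg n M S (y.1.1 + unitVec (fine n M) ν, y.1.2)
    · rw [dif_pos h, if_pos h, ext_apply_of _ _ ⟨_, h⟩, mul_zero, add_zero]
    · rw [dif_neg h, if_neg h, ext_apply_of_not _ _ h, norm_zero, zero_pow two_ne_zero, zero_add, zero_sub, norm_mul, norm_neg,
        Complex.norm_natCast, mul_pow]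
  -- non-star bonds: an incoming jump
  have h2 : ∀ z : {b // ¬ starReg n M S b}, Φ z.1 = (n : ℝ) ^ 2 * ‖ext (starReg n M S) A (z.1.1 + unitVec (fine n M) ν, z.1.2)‖ ^ 2 := by
    intro z
    simp only [hΦ]
    rw [ext_apply_of_not _ _ z.2, sub_zero, norm_mul, Complex.norm_natCast, mul_pow]
  rw [hL, ← Fintype.sum_subtype_add_sum_subtype (starReg n M S) Φ, sum_congr rfl fun y _ => h1 y,
    sum_congr rfl fun z _ => h2 z, sum_add_distrib, ← mul_sum, ← mul_sum, sum_nonstar_shift, add_assoc, ← mul_add, ← sum_add_distrib]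
  rfl

/-- **THE DECOMPOSITION**: `Σ_ν ‖∇_ν ιA‖² = Σ_ν ‖igrad_ν A‖² + n²·Σ_{b star} cntR(b)·‖A b‖²`. [folklore] -/
theorem sum_nsq_fdiff_ext_eq (A : {b // starReg n M S b} → ℂ) :
    ∑ ν, nsq (fdiff (fine n M) (n : ℂ) ν *ᵥ ext (starReg n M S) A)
      = ∑ ν, nsq (igrad M S n ν A) + (n : ℝ) ^ 2 * ∑ y : {b // starReg n M S b}, cntR n M S y.1 * ‖A y‖ ^ 2 := by
  rw [sum_congr rfl fun ν _ => nsq_fdiff_ext_eq n M S ν A, sum_add_distrib, ← mul_sum, sum_comm]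
  congr 2
  refine sum_congr rfl fun y _ => ?_
  rw [cntR, sum_mul]
  refine sum_congr rfl fun ν _ => ?_
  split_ifs <;> ring

end Region

end Summit.QuantumFields.BalabanUV.T4Continuum.RegionStarBoundaryCharges

end
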